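import Summits.Ventures.PercRepro.C025ProfileLevelProfile
import Summits.Ventures.PercRepro.C025ProfileSecondRowDirectSumLemmas
import Summits.Ventures.PercRepro.MatroidTruncate

/-!
# THE SECOND ROW ON THE EXPLICIT TRUNCATION `T_r(M₁ ⊕ U_{m,m})` OF EVERY FINITE MATROID `M₁` (night-3 g24)

`proofs/NIGHT3-G24-ONEFLAT.md` §5.  typer-2's `truncate` (`truncate_eRk : ρ_{T_r N}(X) = min(ρ_N(X), r)`), Mathlib's
`disjointSum` with g23's `SecondRow.eRk_disjointSum` (`ρ_{M ⊕ N}(X) = ρ_M(X ∩ E_M) + ρ_N(X ∩ E_N)`) and Mathlib's `freeOn`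
(`eRk_freeOn : ρ(X) = |X|`) give the rank formula `ρ(X) = min(r, ρ₁(X ∩ E₁) + |X ∩ E₂|)` of `T_r(M₁ ⊕ U_{E₂,E₂})`, so
`OneFlat.profileIneq_second_of_split_matroid` applies: THE SECOND ROW `(q, r−1)` OF (Π) HOLDS ON `T_r(M₁ ⊕ U_{m,m})` FOR EVERY
FINITE MATROID `M₁` OF RANK `s` AND EVERY `m`, `r`, `q` WITH `q + 2 ≤ r` AND `r + q ≤ s + m`; C-025 at `(r, r−2)` for `2r − 2 ≤ s + m`.
* `disjointSum_freeOn_finite` — finiteness of the sum (a theorem, not an instance: the cell's typer lint);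
* `gr_truncate_disjointSum_freeOn`, `eRk_truncate_disjointSum_freeOn` — the ground set and the rank formula;
* **`profileIneq_second_truncate_disjointSum_freeOn`**, **`rls_truncate_disjointSum_freeOn`**.
No `def`, no `instance`, no notation.  Axioms: standard.
-/

open scoped Matroid

namespace PercRepro

open Finset ThmH

namespace OneFlat

variable {α : Type} [DecidableEq α]

omit [DecidableEq α] in
/-- The disjoint sum of a finite matroid with the free matroid on a finset is finite. -/
theorem disjointSum_freeOn_finite (M₁ : Matroid α) [M₁.Finite] (E₂ : Finset α)
    (h : Disjoint M₁.E (Matroid.freeOn (E₂ : Set α)).E) :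
    (M₁.disjointSum (Matroid.freeOn (E₂ : Set α)) h).Finite :=
  ⟨by rw [Matroid.disjointSum_ground_eq, Matroid.freeOn_ground]
      exact M₁.ground_finite.union E₂.finite_toSet⟩

/-- The ground set of `T_r(M₁ ⊕ U_{E₂,E₂})` is `gr M₁ ∪ E₂`. -/
theorem gr_truncate_disjointSum_freeOn (M₁ : Matroid α) [M₁.Finite] (E₂ : Finset α)
    (h : Disjoint M₁.E (Matroid.freeOn (E₂ : Set α)).E) (r : ℕ) :
    haveI := disjointSum_freeOn_finite M₁ E₂ h
    gr (Matroid.truncate (M₁.disjointSum (Matroid.freeOn (E₂ : Set α)) h) r) = gr M₁ ∪ E₂ := by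
  haveI := disjointSum_freeOn_finite M₁ E₂ h
  apply Finset.coe_injective
  rw [coe_union, coe_gr, coe_gr, Matroid.truncate_ground, Matroid.disjointSum_ground_eq, Matroid.freeOn_ground]

/-- The rank formula of `T_r(M₁ ⊕ U_{E₂,E₂})`: `ρ(X) = min(r, ρ₁(X ∩ E₁) + |X ∩ E₂|)`. -/
theorem eRk_truncate_disjointSum_freeOn (M₁ : Matroid α) [M₁.Finite] (E₂ : Finset α)
    (h : Disjoint M₁.E (Matroid.freeOn (E₂ : Set α)).E) (r : ℕ) (X : Finset α) :
    haveI := disjointSum_freeOn_finite M₁ E₂ h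
    (Matroid.truncate (M₁.disjointSum (Matroid.freeOn (E₂ : Set α)) h) r).eRk (X : Set α) =
      ((min r ((M₁.eRk ((X ∩ gr M₁ : Finset α) : Set α)).toNat + (X ∩ E₂).card) : ℕ) : ℕ∞) := by
  haveI := disjointSum_freeOn_finite M₁ E₂ h
  have hfin : M₁.eRk ((X ∩ gr M₁ : Finset α) : Set α) ≠ ⊤ :=
    ne_top_of_le_ne_top (M₁.eRank_ne_top_iff.2 inferInstance) (M₁.eRk_le_eRank _)
  rw [Matroid.truncate_eRk, SecondRow.eRk_disjointSum, Matroid.freeOn_ground,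
    Matroid.eRk_freeOn Set.inter_subset_right]
  have e1 : M₁.eRk ((X : Set α) ∩ M₁.E) = (((M₁.eRk ((X ∩ gr M₁ : Finset α) : Set α)).toNat : ℕ) : ℕ∞) := by
    rw [coe_inter, coe_gr] at hfin ⊢
    exact (ENat.coe_toNat hfin).symm
  have e2 : ((X : Set α) ∩ (E₂ : Set α)).encard = ((X ∩ E₂).card : ℕ∞) := by
    rw [← coe_inter, Set.encard_coe_eq_coe_finsetCard]
  rw [e1, e2, min_comm]
  set a := (M₁.eRk ((X ∩ gr M₁ : Finset α) : Set α)).toNat with ha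
  set b := (X ∩ E₂).card with hb
  rcases le_total r (a + b) with hle | hle
  · rw [min_eq_left hle, min_eq_left (by exact_mod_cast hle)]
  · rw [min_eq_right hle, min_eq_right (by exact_mod_cast hle)]
    push_cast
    rfl

/-- **THE SECOND ROW `(q, r−1)` OF (Π) ON `T_r(M₁ ⊕ U_{m,m})` FOR EVERY FINITE MATROID `M₁`** of rank `s`, `m = #E₂`,
`q + 2 ≤ r`, `r + q ≤ s + m` — an explicit matroid, no hypothesis left. -/
theorem profileIneq_second_truncate_disjointSum_freeOn (M₁ : Matroid α) [M₁.Finite] (E₂ : Finset α)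
    (h : Disjoint M₁.E (Matroid.freeOn (E₂ : Set α)).E) {s : ℕ} (hs : M₁.eRank = (s : ℕ∞)) (r q : ℕ)
    (hq : q + 2 ≤ r) (hreg : r + q ≤ s + E₂.card) :
    haveI := disjointSum_freeOn_finite M₁ E₂ h
    Profile.ProfileIneq (Matroid.truncate (M₁.disjointSum (Matroid.freeOn (E₂ : Set α)) h) r) q (r - 1) := by
  haveI := disjointSum_freeOn_finite M₁ E₂ h
  have hdisj : Disjoint (gr M₁) E₂ := by
    rw [← disjoint_coe, coe_gr]
    rw [Matroid.freeOn_ground] at h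
    exact h
  exact profileIneq_second_of_split_matroid _ M₁ E₂ r (gr_truncate_disjointSum_freeOn M₁ E₂ h r) hdisj hs
    (fun X _ => eRk_truncate_disjointSum_freeOn M₁ E₂ h r X) q hq hreg

/-- **C-025 AT `(r, r−2)` ON `T_r(M₁ ⊕ U_{m,m})` FOR EVERY FINITE MATROID `M₁`**, `2r − 2 ≤ s + m`. -/
theorem rls_truncate_disjointSum_freeOn (M₁ : Matroid α) [M₁.Finite] (E₂ : Finset α)
    (h : Disjoint M₁.E (Matroid.freeOn (E₂ : Set α)).E) {s : ℕ} (hs : M₁.eRank = (s : ℕ∞)) (r : ℕ)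
    (hr : 2 ≤ r) (hreg : 2 * r ≤ s + E₂.card + 2) :
    haveI := disjointSum_freeOn_finite M₁ E₂ h
    ThmN.RLS (Matroid.truncate (M₁.disjointSum (Matroid.freeOn (E₂ : Set α)) h) r) r (r - 2) := by
  haveI := disjointSum_freeOn_finite M₁ E₂ h
  apply GirthRows.rls_of_profileIneq_rows
  intro u hu1 hu2
  have hu : u = r - 1 := by omega
  subst hu
  exact profileIneq_second_truncate_disjointSum_freeOn M₁ E₂ h hs r (r - 2) (by omega) (by omega)

end OneFlat

end PercRepro
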